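import Summits.QuantumFields.YangMills.Theorems.BalabanUVNodesN15KingModelHeatKernelCovariantFullPropagatorPowerLaw
import Summits.QuantumFields.YangMills.Theorems.BalabanUVNodesN15KingModelFullPropagatorDiagonal
import HarnessLib

/-!
# BalabanUVNodes ∕ N15 — THE KING-MODEL RUNG (PART Ϻ-h): PART Ϻ BY NAME — THE η-UNIFORM INVERSE-SQUARE LAWS OF THE ONE-LEVEL KING MODEL (covariance, FULL propagator, NE2's UNIT LAYER; flat and at every
# unitary link field), the SHARPNESS of the `L⁻²` scale on the diagonal (`1∕(m²+8+a) ≤ L²A₀⁻¹(u,u) ≤ C_full`), one constant for every `L`, `M₀`, `T`, `U`, and «what the curved case adds» in one theorem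
# (Track A, DAG node N15 = NE2; FAN-OUT v1.1 §N15 s3 «KING-MODEL RUNG … + the one-line statement of what the curved case adds»; count-neutral)

HONEST FRAMING.  Count-neutral (cell `pub-ymgap`, seat `pub-ymgap-dag-n15-e` g56; `--supports stmt-QuantumFields-27247 --as helper` = K3ᴬ, KEY MAP v3).  King's one-level comparison model on the cubic fine
four-torus `(ℤ∕LM₀)⁴` over the block torus `(ℤ∕M₀)⁴`, King's scaling `c = L²` ([King1986] (2.13)–(2.14) p.653, (4.1)–(4.5) p.670), with Bałaban's covariant block mean at a unitary link field `U` ([B9] (3.19),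
(3.24)–(3.26)).  THIS FILE packages PART Ϻ (files Ϻ-a…Ϻ-g) and adds the diagonal floor:
* §1 ★★★ **`king_fullProp_diag_ge_eta_uniform`** (`1∕(m²+8+a) ≤ L²·A₀⁻¹(u,u)` for every `L ≥ 1` — O-c `Curved.fineOp_inv_diag_ge` (`A₀⁻¹(x,x) ≥ 1∕A₀(x,x)`) at `c = L²`, `d′ = 4`), ★★★ **`king_fullProp_diag_two_sided`**
  (`1∕(m²+8+a) ≤ L²A₀⁻¹(u,u) ≤ C_full(a,m²)`: the `η²` scale of the inverse-square law IS attained — the law is sharp up to constants on the diagonal);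
* §2 ★★★★ **`king_inverseSquare_package`** — at `U ≡ 1`: (i) the covariance `L²|G(u,v)| ≤ C₀∕(1+dist²)` (Ϣ-j), (ii) the FULL propagator `L²|A₀⁻¹(u,v)| ≤ C_full∕(1+dist²)` (Ϻ-d), (iii) the diagonal floor (§1),
  (iv) NE2's unit layer `0 ≤ (C−a⁻¹1)(y,y′) ≤ 8C₀∕(1+dist_M²)` (Ϻ-e) — every `L`, every `M₀`;
* §3 ★★★★ **`king_inverseSquare_what_the_curved_case_adds`** — at EVERY unitary `U`, every tree contour system, any `RCLike` fibre: (i′) `L²‖(M_U⁻¹)_{uv}‖ ≤ C₀∕(1+dist²)` (Kato, Ͱ-b ⊕ Ϣ-j),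
  (ii′) `L²‖(A₀(U)⁻¹)_{uv}‖ ≤ C^U_full∕(1+dist²)` (Ϻ-g, mass-floor constants), (iv′) `‖((Δ_eff(U))⁻¹)_{yy′} − a⁻¹δ·1‖ ≤ 8C₀∕(1+dist_M²)` (Ϻ-e §3, SAME constant as flat) — the one-line answer of the FAN-OUT row:
  the curved case adds NOTHING to the covariance and unit layers and only replaces King's flat decay constants `(C_Δ,κ_A)` by the mass-floor ones `(a+2a²e²∕m², ctRate(m²,a,3))` in the full layer;
* §4 ★★★ `king_inverseSquare_exists` — ONE constant `C(a,m²)` for all three layers, flat and curved, every `L`, `M₀`, `T`, `U`.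
HONEST SCOPE: King's `A = 0` ∕ one-level covariant comparison model; `d+1 = 4`, `c = L²`, `m² > 0`, `a > 0`; crude absolute constants, mass-dependent; power laws only (the exponential tail beyond the
correlation length is the tree's Combes–Thomas ∕ `effLaplacian(_inv)_decay`, not combined here); NOT Bałaban's multi-level `G_k(U)`, `C^{(k)}(U)` ∕ [B9] (3.42); NOT a node discharge (N15 of record untouched);
nothing continuum ∕ ℝ⁴ ∕ OS ∕ mass gap ∕ Clay.
PRIOR TREE ART (by name): Ϻ-d `king_fullProp_powerLaw_eta_uniform`, Ϻ-e `king_blockCov_powerLaw_eta_uniform`∕`norm_blk_effLapU_inv_sub_noise_le_powerLaw`, Ϻ-g `king_fullPropU_powerLaw_eta_uniform`, Ϣ-j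
`king_green_powerLaw_tdistT`, O-c `Curved.fineOp_inv_diag_ge`, Ͱ-b `l2_opNorm_blk_inv_le`∕`lapF_inv_entry_nonneg`, Ϧ `ctRate`∕`ctRate_pos`, King1986.Torus (`fineOp`, `effLaplacian`, `lapF`, `CDelta`, `kapA`,
`tdistT`), B4Sect5Proof `latticeConst(_nonneg)`, `Beta.WoodburyFibre.cM`, `LatticeDiamagneticInequality.blk`.  Dedup (rg at filing): basename 0 files; needles
`king_fullProp_diag_ge_eta_uniform|king_fullProp_diag_two_sided|king_inverseSquare_package|king_inverseSquare_what_the_curved_case_adds|king_inverseSquare_exists` 0 tree files.  presearch: n/a (package of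
in-tree theorems).  Locators: [King1986] C. King, CMP 102 (1986) 649–677: (2.13)–(2.14) p.653, (3.63) p.663, (4.1)–(4.5) p.670, (4.33)–(4.34) p.674, (4.44)–(4.45) p.675; [Balaban1985BackgroundPropagators]
(3.19) p.393, (3.23)–(3.26) p.394, Thm 3.1 ∕ (3.42) p.397 (NOT asserted), Thm 3.4 p.400; [Balaban1984PropagatorsI] (1.29) p.23; [Dimock2013] App. D Lemmas 29–30.  0 `sorry`, 0 `def`.
-/

noncomputable section

open scoped BigOperators ComplexConjugate ComplexOrder Matrix.Norms.L2Operator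
open Finset Matrix

namespace Summit.QuantumFields.YangMills.BalabanUVNodes.N15KingModelRung.HeatKernel

open Literature.MathematicalPhysics.QuantumFieldTheory.LatticeDiamagneticInequality (blk)
open Literature.MathematicalPhysics.QuantumFieldTheory.Balaban1983to89.B5Prop11Plancherel (Tor fine)
open Literature.MathematicalPhysics.QuantumFieldTheory.Balaban1983to89.Beta.WoodburyFibre (cM)
open Literature.MathematicalPhysics.QuantumFieldTheory.Balaban1983to89 (B4Sect5Proof.latticeConst B4Sect5Proof.latticeConst_nonneg)
open Literature.MathematicalPhysics.QuantumFieldTheory.King1986.Torus (lapF fineOp effLaplacian tdistT tdistT_nonneg CDelta kapA kapA_pos CDelta_pos)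
open Summit.QuantumFields.YangMills.BalabanUVNodes.N15KingModelRung.Covariant (covLapF l2_opNorm_blk_inv_le lapF_inv_entry_nonneg)
open Summit.QuantumFields.YangMills.BalabanUVNodes.N15KingModelRung.CovariantBlock (BlockTree fullOpU effLapU)
open Summit.QuantumFields.YangMills.BalabanUVNodes.N15KingModelRung.CombesThomas (ctRate ctRate_pos)
open Summit.QuantumFields.YangMills.BalabanUVNodes.N15KingModelRung.Curved (fineOp_inv_diag_ge)

/-! ## §1 The diagonal floor: the `η²` scale is attained -/

section Flat

variable (L M₀ : ℕ) [NeZero L] [NeZero M₀] {a m2 : ℝ}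

/-- ★★★ **THE DIAGONAL FLOOR**: `1∕(m² + 8 + a) ≤ L²·A₀⁻¹(u,u)` for every `L ≥ 1`, every `M₀`, all `u` (`A₀⁻¹(u,u) ≥ 1∕A₀(u,u) = 1∕(m² + 8L² + aL⁻⁴·L⁴∕L⁴)`-type floor from O-c, and `L² ≥ 1`).
[cite: King1986, (2.13) p.653, (3.63) p.663, (4.5) p.670] -/
theorem king_fullProp_diag_ge_eta_uniform (ha : 0 < a) (hm : 0 < m2) (u : Tor (fine L (cM M₀))) :
    1 / (m2 + 8 + a) ≤ (L : ℝ) ^ 2 * (fineOp L (cM M₀) a ((L : ℝ) ^ 2) m2)⁻¹ u u := by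
  have hL1 : (1 : ℝ) ≤ L := by exact_mod_cast Nat.one_le_iff_ne_zero.mpr (NeZero.ne L)
  have hL2 : (1 : ℝ) ≤ (L : ℝ) ^ 2 := by nlinarith
  have h := fineOp_inv_diag_ge L (cM M₀) ha.le (by positivity : (0 : ℝ) ≤ (L : ℝ) ^ 2) hm u
  have hpos : 0 < m2 + 2 * (4 : ℕ) * (L : ℝ) ^ 2 + a := by positivity
  have hdiag0 : 0 ≤ (fineOp L (cM M₀) a ((L : ℝ) ^ 2) m2)⁻¹ u u := le_trans (by positivity) h
  -- `L²∕(m² + 8L² + a) ≥ 1∕(m² + 8 + a)`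
  have h1 : 1 / (m2 + 8 + a) ≤ (L : ℝ) ^ 2 * (1 / (m2 + 2 * (4 : ℕ) * (L : ℝ) ^ 2 + a)) := by
    rw [mul_one_div, div_le_div_iff₀ (by positivity) hpos]
    push_cast
    nlinarith
  exact h1.trans (mul_le_mul_of_nonneg_left h (by positivity))

/-- ★★★ **THE INVERSE-SQUARE LAW IS SHARP ON THE DIAGONAL**: `1∕(m²+8+a) ≤ L²·A₀⁻¹(u,u) ≤ C_full(a,m²)` for every `L ≥ 1`, every `M₀ ≥ 1` — the full one-step propagator's diagonal IS of order `η² = L⁻²`.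
[cite: King1986, (2.13) p.653, (3.63) p.663, (4.33) p.674] -/
theorem king_fullProp_diag_two_sided (ha : 0 < a) (hm : 0 < m2) (u : Tor (fine L (cM M₀))) :
    1 / (m2 + 8 + a) ≤ (L : ℝ) ^ 2 * (fineOp L (cM M₀) a ((L : ℝ) ^ 2) m2)⁻¹ u u
      ∧ (L : ℝ) ^ 2 * (fineOp L (cM M₀) a ((L : ℝ) ^ 2) m2)⁻¹ u u
          ≤ (34016 + 10 / m2) * (1 + 98 * (CDelta a 4 * B4Sect5Proof.latticeConst 4 (kapA a 4)) / m2) + 50 * CDelta a 4 * (1 + (kapA a 4 ^ 2)⁻¹) / m2 ^ 2 := by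
  refine ⟨king_fullProp_diag_ge_eta_uniform L M₀ ha hm u, ?_⟩
  have h := king_fullProp_diag_le_eta_uniform L M₀ ha hm u u
  exact le_trans (mul_le_mul_of_nonneg_left (le_abs_self _) (by positivity)) h

/-! ## §2 PART Ϻ by name at `U ≡ 1` -/

/-- ★★★★ **THE η-UNIFORM INVERSE-SQUARE LAWS OF KING's ONE-LEVEL MODEL, BY NAME** (`U ≡ 1`; every `L ≥ 1`, every `M₀ ≥ 1`; `C₀ = 34016+10∕m²`): (i) covariance `L²|G(u,v)| ≤ C₀∕(1+dist²)`; (ii) FULL propagator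
`L²|A₀⁻¹(u,v)| ≤ C_full∕(1+dist²)`; (iii) diagonal floor `1∕(m²+8+a) ≤ L²A₀⁻¹(u,u)`; (iv) NE2's unit layer `0 ≤ (C−a⁻¹1)(y,y′) ≤ 8C₀∕(1+dist_M²)`.
[cite: King1986, (2.13)–(2.14) p.653, (3.63) p.663, (4.4)–(4.5) p.670, (4.34) p.674, (4.44)–(4.45) p.675] -/
theorem king_inverseSquare_package (ha : 0 < a) (hm : 0 < m2) :
    (∀ u v : Tor (fine L (cM M₀)), (L : ℝ) ^ 2 * |(lapF (fine L (cM M₀)) ((L : ℝ) ^ 2) m2)⁻¹ u v| ≤ (34016 + 10 / m2) / (1 + tdistT (fine L (cM M₀)) u v ^ 2))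
      ∧ (∀ u v : Tor (fine L (cM M₀)), (L : ℝ) ^ 2 * |(fineOp L (cM M₀) a ((L : ℝ) ^ 2) m2)⁻¹ u v|
          ≤ ((34016 + 10 / m2) * (1 + 98 * (CDelta a 4 * B4Sect5Proof.latticeConst 4 (kapA a 4)) / m2) + 50 * CDelta a 4 * (1 + (kapA a 4 ^ 2)⁻¹) / m2 ^ 2)
              / (1 + tdistT (fine L (cM M₀)) u v ^ 2))
      ∧ (∀ u : Tor (fine L (cM M₀)), 1 / (m2 + 8 + a) ≤ (L : ℝ) ^ 2 * (fineOp L (cM M₀) a ((L : ℝ) ^ 2) m2)⁻¹ u u)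
      ∧ (∀ y y' : Tor (cM M₀), 0 ≤ ((effLaplacian L (cM M₀) a ((L : ℝ) ^ 2) m2)⁻¹ - a⁻¹ • (1 : Matrix (Tor (cM M₀)) (Tor (cM M₀)) ℝ)) y y'
          ∧ ((effLaplacian L (cM M₀) a ((L : ℝ) ^ 2) m2)⁻¹ - a⁻¹ • (1 : Matrix (Tor (cM M₀)) (Tor (cM M₀)) ℝ)) y y' ≤ 8 * (34016 + 10 / m2) / (1 + tdistT (cM M₀) y y' ^ 2)) :=
  ⟨fun u v => king_green_powerLaw_tdistT L M₀ hm u v, fun u v => king_fullProp_powerLaw_eta_uniform L M₀ ha hm u v,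
    fun u => king_fullProp_diag_ge_eta_uniform L M₀ ha hm u, fun y y' => king_blockCov_powerLaw_eta_uniform L M₀ ha hm y y'⟩

end Flat

/-! ## §3 What the curved case adds — the one-line answer, as a theorem -/

section Curved

variable {L : ℕ} [NeZero L] (T : BlockTree 3 L) (M₀ : ℕ) [NeZero M₀]
variable {𝕜 : Type*} [RCLike 𝕜] {n : Type*} [Fintype n] [DecidableEq n] {a m2 : ℝ}

/-- ★★★★ **WHAT THE CURVED CASE ADDS** (FAN-OUT §N15 s3's one line, as a theorem): for every tree contour system, EVERY unitary `U` on `(ℤ∕LM₀)⁴`, any `RCLike` fibre, every `L ≥ 1`, every `M₀ ≥ 1`: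
(i′) the covariant fine covariance `L²‖((−L²Δ_U+m²)⁻¹)_{uv}‖ ≤ C₀∕(1+dist²)` — SAME constant as flat (Kato); (ii′) the full background propagator `L²‖(A₀(U)⁻¹)_{uv}‖ ≤ C^U_full∕(1+dist²)` — the flat books with
the mass-floor decay constants; (iv′) NE2's unit layer `‖((Δ_eff(U))⁻¹)_{yy′} − a⁻¹δ·1‖ ≤ 8C₀∕(1+dist_M²)` — SAME constant as flat (domination).
[cite: Balaban1985BackgroundPropagators, (3.19) p.393, (3.23)–(3.26) p.394, Thm 3.4 p.400; King1986, (2.13)–(2.14) p.653, (4.34) p.674, (4.45) p.675; DodziukMathai2006, Thm 1.5 §1] -/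
theorem king_inverseSquare_what_the_curved_case_adds (ha : 0 < a) (hm : 0 < m2) {U : Tor (fine L (cM M₀)) × Fin 4 → Matrix n n 𝕜} (hU : ∀ bd, U bd ∈ Matrix.unitaryGroup n 𝕜) :
    (∀ u v : Tor (fine L (cM M₀)), (L : ℝ) ^ 2 * ‖blk ((covLapF (fine L (cM M₀)) ((L : ℝ) ^ 2) m2 U)⁻¹) u v‖ ≤ (34016 + 10 / m2) / (1 + tdistT (fine L (cM M₀)) u v ^ 2))
      ∧ (∀ u v : Tor (fine L (cM M₀)), (L : ℝ) ^ 2 * ‖blk ((fullOpU T (cM M₀) a ((L : ℝ) ^ 2) m2 U)⁻¹) u v‖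
          ≤ ((34016 + 10 / m2) * (1 + 98 * ((a + a ^ 2 * (2 / m2) * Real.exp 2) * B4Sect5Proof.latticeConst 4 (ctRate m2 a 3)) / m2)
              + 50 * (a + a ^ 2 * (2 / m2) * Real.exp 2) * (1 + (ctRate m2 a 3 ^ 2)⁻¹) / m2 ^ 2) / (1 + tdistT (fine L (cM M₀)) u v ^ 2))
      ∧ (∀ y y' : Tor (cM M₀), ‖blk ((effLapU T (cM M₀) a ((L : ℝ) ^ 2) m2 U)⁻¹) y y' - (if y = y' then (a⁻¹ : 𝕜) else 0) • (1 : Matrix n n 𝕜)‖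
          ≤ 8 * (34016 + 10 / m2) / (1 + tdistT (cM M₀) y y' ^ 2)) := by
  refine ⟨fun u v => ?_, fun u v => king_fullPropU_powerLaw_eta_uniform T M₀ ha hm hU u v, fun y y' => norm_blk_effLapU_inv_sub_noise_le_powerLaw T M₀ ha hm hU y y'⟩
  have hc : (0 : ℝ) ≤ (L : ℝ) ^ 2 := by positivity
  have h1 := l2_opNorm_blk_inv_le (fine L (cM M₀)) hc hm hU u v
  have h2 := king_green_powerLaw_tdistT L M₀ hm u v
  have h3 : (lapF (fine L (cM M₀)) ((L : ℝ) ^ 2) m2)⁻¹ u v ≤ |(lapF (fine L (cM M₀)) ((L : ℝ) ^ 2) m2)⁻¹ u v| := le_abs_self _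
  nlinarith [norm_nonneg (blk ((covLapF (fine L (cM M₀)) ((L : ℝ) ^ 2) m2 U)⁻¹) u v)]

end Curved

/-! ## §4 One constant for everything -/

/-- ★★★ **ONE CONSTANT `C(a,m²)` FOR ALL THREE LAYERS, FLAT AND CURVED**: for every `L ≥ 1`, `M₀ ≥ 1`, tree contour system `T`, unitary `U` (fibre `𝕜ⁿ` fixed) and all points:
`L²|G| , L²|A₀⁻¹| , L²‖(M_U⁻¹)_{uv}‖ , L²‖(A₀(U)⁻¹)_{uv}‖ ≤ C∕(1+dist²)` and `(C−a⁻¹1)(y,y′), ‖((Δ_eff(U))⁻¹)_{yy′} − a⁻¹δ·1‖ ≤ C∕(1+dist_M²)`.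
[cite: King1986, (2.13)–(2.14) p.653, (3.63) p.663; Balaban1985BackgroundPropagators, Thm 3.1 p.397 (shape, one level), Thm 3.4 p.400] -/
theorem king_inverseSquare_exists {𝕜 : Type*} [RCLike 𝕜] {n : Type*} [Fintype n] [DecidableEq n] {a m2 : ℝ} (ha : 0 < a) (hm : 0 < m2) :
    ∃ C : ℝ, 0 < C ∧ ∀ (L M₀ : ℕ) [NeZero L] [NeZero M₀] (T : BlockTree 3 L) (U : Tor (fine L (cM M₀)) × Fin 4 → Matrix n n 𝕜), (∀ bd, U bd ∈ Matrix.unitaryGroup n 𝕜) →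
      (∀ u v : Tor (fine L (cM M₀)), (L : ℝ) ^ 2 * |(lapF (fine L (cM M₀)) ((L : ℝ) ^ 2) m2)⁻¹ u v| ≤ C / (1 + tdistT (fine L (cM M₀)) u v ^ 2))
        ∧ (∀ u v : Tor (fine L (cM M₀)), (L : ℝ) ^ 2 * |(fineOp L (cM M₀) a ((L : ℝ) ^ 2) m2)⁻¹ u v| ≤ C / (1 + tdistT (fine L (cM M₀)) u v ^ 2))
        ∧ (∀ u v : Tor (fine L (cM M₀)), (L : ℝ) ^ 2 * ‖blk ((covLapF (fine L (cM M₀)) ((L : ℝ) ^ 2) m2 U)⁻¹) u v‖ ≤ C / (1 + tdistT (fine L (cM M₀)) u v ^ 2))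
        ∧ (∀ u v : Tor (fine L (cM M₀)), (L : ℝ) ^ 2 * ‖blk ((fullOpU T (cM M₀) a ((L : ℝ) ^ 2) m2 U)⁻¹) u v‖ ≤ C / (1 + tdistT (fine L (cM M₀)) u v ^ 2))
        ∧ (∀ y y' : Tor (cM M₀), ((effLaplacian L (cM M₀) a ((L : ℝ) ^ 2) m2)⁻¹ - a⁻¹ • (1 : Matrix (Tor (cM M₀)) (Tor (cM M₀)) ℝ)) y y' ≤ C / (1 + tdistT (cM M₀) y y' ^ 2))
        ∧ (∀ y y' : Tor (cM M₀), ‖blk ((effLapU T (cM M₀) a ((L : ℝ) ^ 2) m2 U)⁻¹) y y' - (if y = y' then (a⁻¹ : 𝕜) else 0) • (1 : Matrix n n 𝕜)‖ ≤ C / (1 + tdistT (cM M₀) y y' ^ 2)) := by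
  -- the four constants
  set C0 : ℝ := 34016 + 10 / m2 with hC0
  set C1 : ℝ := (34016 + 10 / m2) * (1 + 98 * (CDelta a 4 * B4Sect5Proof.latticeConst 4 (kapA a 4)) / m2) + 50 * CDelta a 4 * (1 + (kapA a 4 ^ 2)⁻¹) / m2 ^ 2 with hC1
  set C2 : ℝ := (34016 + 10 / m2) * (1 + 98 * ((a + a ^ 2 * (2 / m2) * Real.exp 2) * B4Sect5Proof.latticeConst 4 (ctRate m2 a 3)) / m2)
      + 50 * (a + a ^ 2 * (2 / m2) * Real.exp 2) * (1 + (ctRate m2 a 3 ^ 2)⁻¹) / m2 ^ 2 with hC2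
  set C3 : ℝ := 8 * (34016 + 10 / m2) with hC3
  have hC00 : 0 < C0 := by positivity
  have hCS1 : 0 ≤ CDelta a 4 * B4Sect5Proof.latticeConst 4 (kapA a 4) := CDelta_mul_latticeConst_nonneg ha
  have hκ1 : 0 ≤ (kapA a 4 ^ 2)⁻¹ := inv_nonneg.mpr (pow_pos (kapA_pos ha 4) 2).le
  have hCD := (CDelta_pos ha 4).le
  have hC10 : 0 ≤ C1 := by positivity
  have hCS2 : 0 ≤ (a + a ^ 2 * (2 / m2) * Real.exp 2) * B4Sect5Proof.latticeConst 4 (ctRate m2 a 3) :=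
    mul_nonneg (by positivity) (B4Sect5Proof.latticeConst_nonneg 4 (ctRate_pos hm ha.le 3).le)
  have hκ2 : 0 ≤ (ctRate m2 a 3 ^ 2)⁻¹ := inv_nonneg.mpr (pow_pos (ctRate_pos hm ha.le 3) 2).le
  have hC20 : 0 ≤ C2 := by positivity
  have hC30 : 0 ≤ C3 := by positivity
  refine ⟨C0 + C1 + C2 + C3, by positivity, fun L M₀ _ _ T U hU => ?_⟩
  obtain ⟨hG, hA, -, hC⟩ := king_inverseSquare_package L M₀ ha hm
  obtain ⟨hGU, hAU, hCU⟩ := king_inverseSquare_what_the_curved_case_adds T M₀ ha hm hU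
  have mono : ∀ {X t : ℝ} (K : ℝ), X ≤ K / (1 + t ^ 2) → K ≤ C0 + C1 + C2 + C3 → X ≤ (C0 + C1 + C2 + C3) / (1 + t ^ 2) :=
    fun K h hK => h.trans (div_le_div_of_nonneg_right hK (by positivity))
  refine ⟨fun u v => mono C0 (hG u v) (by linarith), fun u v => mono C1 (hA u v) (by linarith), fun u v => mono C0 (hGU u v) (by linarith),
    fun u v => mono C2 (hAU u v) (by linarith), fun y y' => mono C3 (hC y y').2 (by linarith), fun y y' => mono C3 (hCU y y') (by linarith)⟩

end Summit.QuantumFields.YangMills.BalabanUVNodes.N15KingModelRung.HeatKernel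

end
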